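import Mathlib.GroupTheory.Perm.Fin
import Literature.Combinatorics.SimpleGraph.MatchingMinorPfaffian
import HarnessLib

/-!
# Bicontraction reflects Pfaffian-ness (Little's theorem, hard direction: tools I)

Topic `Combinatorics/SimpleGraph`; theorems only. Part of the discharge of the named fact
`Little1975_isPfaffianBipartite_iff_not_isMatchingMinor` (`LittleTheorem.lean`), hard direction
("no `K_{3,3}` matching minor ⇒ Pfaffian"), which is proved by descending induction along matching
minors: a vertex of degree two of a minimal non-Pfaffian bipartite graph is bicontracted, and one
needs that the bicontraction is again NON-Pfaffian. `MatchingMinorPfaffian.lean` proves that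
bicontraction PRESERVES Pfaffian-ness (`isPfaffianBipartite_bicontractRowZero`); here the converse:

* `IsPolyaSigning.of_bicontractRowZero` / `IsPfaffianBipartite.of_bicontractRowZero` — if row `0`
  of `G ⊆ K_{m+2,m+2}` has degree two with neighbours the columns `0, 1` (normal position,
  `RowZeroBicontractible`) and the bicontraction `bicontractRowZero G` has a Pólya signing `s'`,
  then `G` has the Pólya signing `liftSigning`: `+1` on the two edges of row `0`, `s' (a, b)` on
  `(a+1, b+1)` (so the column `1` inherits the signs of the merged column) and `-s' (a, 0)` on
  `(a+1, 0)`. A perfect matching `σ` of `G` matches row `0` to the column `p ∈ {0, 1}` and is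
  `decomposeFin.symm (p, σ')` for the perfect matching `σ'` of the bicontraction it induces; for
  `p = 0` signs and weights agree, for `p = 1` both change sign.
* `isPfaffianBipartite_bicontractRowZero_iff` — hence **`G` is Pfaffian iff its bicontraction is**
  (Little 1975, §4, "reduction": "the graph of `X` is isomorphic to an even subdivision of the
  graph of `Y`", and even subdivision does not change convertibility).

## References

* C. H. C. Little, *A characterization of convertible (0,1)-matrices*, J. Combin. Theory Ser. B
  18 (1975) 187–208, §4 (reduction; Corollary 1). [Little1975]
* N. Robertson, P. D. Seymour, R. Thomas, *Permanents, Pfaffian orientations, and even directed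
  circuits*, Ann. of Math. 150 (1999) 929–975, §4 (bicontraction). [RobertsonSeymourThomas1999]
-/

namespace Literature.Combinatorics.SimpleGraph

open Equiv Finset

variable {m : ℕ}

/-- In normal position, a perfect matching matches row `0` to the column `0` or `1`. [folklore] -/
theorem RowZeroBicontractible.perm_zero {G : Finset (Fin (m + 2) × Fin (m + 2))}
    (hG : RowZeroBicontractible G) {σ : Perm (Fin (m + 2))} (hσ : ∀ i, (i, σ i) ∈ G) :
    σ 0 = 0 ∨ σ 0 = 1 :=
  (hG.zero_mem_iff (σ 0)).1 (hσ 0)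

/-- **The perfect matching of the bicontraction induced by a perfect matching of `G`**: the second
component of `Equiv.Perm.decomposeFin σ`; row `a` goes to `shiftDown (σ (a+1))`. It is a perfect
matching of `bicontractRowZero G`. [folklore] -/
theorem RowZeroBicontractible.decomposeFin_mem {G : Finset (Fin (m + 2) × Fin (m + 2))}
    (hG : RowZeroBicontractible G) {σ : Perm (Fin (m + 2))} (hσ : ∀ i, (i, σ i) ∈ G)
    (a : Fin (m + 1)) : (a, (Perm.decomposeFin σ).2 a) ∈ bicontractRowZero G := by
  set p := (Perm.decomposeFin σ).1 with hp
  set σ' := (Perm.decomposeFin σ).2 with hσ'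
  have hdec : σ = Perm.decomposeFin.symm (p, σ') := by
    rw [hp, hσ', Prod.mk.eta, Equiv.symm_apply_apply]
  have hsucc : σ a.succ = swap 0 p (σ' a).succ := by
    conv_lhs => rw [hdec]
    exact Perm.decomposeFin_symm_apply_succ σ' p a
  have h0 : σ 0 = p := by
    conv_lhs => rw [hdec]
    exact Perm.decomposeFin_symm_apply_zero p σ'
  have ha := hσ a.succ
  rw [hsucc] at ha
  rw [mem_bicontractRowZero_iff]
  rcases hG.perm_zero hσ with h | h
  · rw [h0] at h
    rw [h, swap_self, Equiv.refl_apply] at ha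
    exact Or.inl ha
  · rw [h0] at h
    rw [h] at ha
    by_cases hz : σ' a = 0
    · rw [hz, Fin.succ_zero_eq_one, swap_apply_right] at ha
      exact Or.inr ⟨hz, ha⟩
    · rw [swap_apply_of_ne_of_ne (Fin.succ_ne_zero _) (fun h1 => hz ((succ_eq_one_iff _).1 h1))]
        at ha
      exact Or.inl ha

/-- **Bicontraction reflects Pólya signings** (normal position). If `s'` is a Pólya signing of
`bicontractRowZero G`, then the lifted signing — `1` on row `0`, `s' (shiftDown i, shiftDown j)`
on `(i, j)` with `j ≠ 0`, and `-s' (shiftDown i, 0)` on `(i, 0)`, for `i ≠ 0` — is a Pólya signing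
of `G`. [cite: Little1975, §4 (reduction)] -/
theorem IsPolyaSigning.of_bicontractRowZero {G : Finset (Fin (m + 2) × Fin (m + 2))}
    (hG : RowZeroBicontractible G) {s' : Fin (m + 1) × Fin (m + 1) → ℤˣ}
    (hs' : IsPolyaSigning (Literature.Combinatorics.SimpleGraph.bicontractRowZero G) s') :
    IsPolyaSigning G (fun e => if e.1 = 0 then 1 else
      (if e.2 = 0 then -1 else 1) * s' (shiftDown e.1, shiftDown e.2)) := by
  intro σ hσ
  set p := (Perm.decomposeFin σ).1 with hp
  set σ' := (Perm.decomposeFin σ).2 with hσ'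
  have hdec : σ = Perm.decomposeFin.symm (p, σ') := by
    rw [hp, hσ', Prod.mk.eta, Equiv.symm_apply_apply]
  have hsucc : ∀ a, σ a.succ = swap 0 p (σ' a).succ := fun a => by
    conv_lhs => rw [hdec]
    exact Perm.decomposeFin_symm_apply_succ σ' p a
  have h0 : σ 0 = p := by
    conv_lhs => rw [hdec]
    exact Perm.decomposeFin_symm_apply_zero p σ'
  have hpol := hs' σ' fun a => hG.decomposeFin_mem hσ a
  have hsign : Perm.sign σ = (if p = 0 then 1 else -1) * Perm.sign σ' := by
    conv_lhs => rw [hdec]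
    exact Perm.decomposeFin.symm_sign p σ'
  -- split the weight of `σ` at row `0`
  rw [hsign, Fin.prod_univ_succ]
  simp only [Fin.succ_ne_zero, if_false, if_true, one_mul, shiftDown_succ]
  rcases hG.perm_zero hσ with hz | hz
  · -- row `0` matched to column `0`: `σ' a = shiftDown (σ (a+1))` with `σ (a+1) ≠ 0`
    rw [h0] at hz
    have hrest : ∀ a, σ a.succ = (σ' a).succ := fun a => by
      rw [hsucc, hz, swap_self, Equiv.refl_apply]
    simp_rw [hz, if_true, hrest, Fin.succ_ne_zero, if_false, shiftDown_succ, one_mul]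
    exact hpol
  · -- row `0` matched to column `1`: the row `a₀ = σ'⁻¹ 0` is matched to column `0` in `σ`
    rw [h0] at hz
    have h10 : (p = 0) = False := by rw [hz]; exact eq_false (Fin.zero_ne_one).symm
    simp only [h10, if_false]
    set a₀ := σ'.symm 0 with ha₀
    have hσa₀ : σ' a₀ = 0 := σ'.apply_symm_apply 0
    have hother : ∀ a, a ≠ a₀ → σ' a ≠ 0 := fun a ha h => ha (σ'.injective (h.trans hσa₀.symm))
    have hrest : ∀ a, a ≠ a₀ → σ a.succ = (σ' a).succ := fun a ha => by
      rw [hsucc, hz, swap_apply_of_ne_of_ne (Fin.succ_ne_zero _)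
        (fun h1 => hother a ha ((succ_eq_one_iff _).1 h1))]
    have haa₀ : σ a₀.succ = 0 := by
      rw [hsucc, hz, hσa₀, Fin.succ_zero_eq_one, swap_apply_right]
    rw [← Finset.mul_prod_erase _ (fun a => s' (a, σ' a)) (Finset.mem_univ a₀)] at hpol
    rw [← Finset.mul_prod_erase Finset.univ
      (fun x => (if σ x.succ = 0 then (-1 : ℤˣ) else 1) * s' (x, shiftDown (σ x.succ)))
      (Finset.mem_univ a₀)]
    have hcongr : ∏ a ∈ Finset.univ.erase a₀,
        (if σ a.succ = 0 then -1 else 1) * s' (a, shiftDown (σ a.succ)) =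
        ∏ a ∈ Finset.univ.erase a₀, s' (a, σ' a) := by
      refine Finset.prod_congr rfl fun a ha => ?_
      rw [hrest a (Finset.ne_of_mem_erase ha)]
      simp
    rw [hcongr, haa₀, if_pos rfl, shiftDown_zero, ← hσa₀]
    rw [← Units.val_eq_one] at hpol ⊢
    push_cast at hpol ⊢
    linear_combination hpol

/-- **The bicontraction of `G` (normal position) is Pfaffian only if `G` is.**
[cite: Little1975, §4 (reduction)] -/
theorem IsPfaffianBipartite.of_bicontractRowZero {G : Finset (Fin (m + 2) × Fin (m + 2))}
    (hG : RowZeroBicontractible G) (h : IsPfaffianBipartite (bicontractRowZero G)) :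
    IsPfaffianBipartite G :=
  let ⟨_, hs'⟩ := h; ⟨_, hs'.of_bicontractRowZero hG⟩

/-- **Pfaffian-ness is invariant under bicontracting a vertex of degree two** (Little 1975, §4:
even subdivision / reduction does not change convertibility): in normal position,
`G` is Pfaffian iff `bicontractRowZero G` is. [cite: Little1975, §4 (reduction)] -/
theorem isPfaffianBipartite_bicontractRowZero_iff {G : Finset (Fin (m + 2) × Fin (m + 2))}
    (hG : RowZeroBicontractible G) :
    IsPfaffianBipartite (bicontractRowZero G) ↔ IsPfaffianBipartite G :=
  ⟨fun h => h.of_bicontractRowZero hG, isPfaffianBipartite_bicontractRowZero hG⟩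

/-- Along a bicontraction step (isomorphisms allowed on both sides) Pfaffian-ness is reflected.
[folklore] -/
theorem BicontractionStep.isPfaffianBipartite_iff {G : Finset (Fin (m + 2) × Fin (m + 2))}
    {G' : Finset (Fin (m + 1) × Fin (m + 1))} (h : BicontractionStep G G') :
    IsPfaffianBipartite G' ↔ IsPfaffianBipartite G := by
  obtain ⟨G₀, hGG₀, hG₀, hG₀G'⟩ := h
  rw [← hG₀G'.isPfaffianBipartite_iff, isPfaffianBipartite_bicontractRowZero_iff hG₀,
    hGG₀.isPfaffianBipartite_iff]

/-- Along a sequence of bicontractions Pfaffian-ness is reflected: if a graph obtained from `G` by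
bicontractions is non-Pfaffian then so is `G`, and conversely. [folklore] -/
theorem Bicontracts.isPfaffianBipartite_iff {n k : ℕ} {G : Finset (Fin n × Fin n)}
    {H : Finset (Fin k × Fin k)} (h : Bicontracts G H) :
    IsPfaffianBipartite H ↔ IsPfaffianBipartite G := by
  induction h with
  | of_isIsomorphic hiso => exact hiso.isPfaffianBipartite_iff.symm
  | step hstep _ ih => exact ih.trans hstep.isPfaffianBipartite_iff

end Literature.Combinatorics.SimpleGraph
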